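import Summits.ResolutionOfSingularities.ResolutionOfSingularities.Theorems.EquisingularLiftEquisingularLiftNatCoheightTwoPrime
import Literature.AlgebraicGeometry.Resolution.GermsOfClosedSubsets
import Literature.AlgebraicGeometry.Resolution.StalkIdealLemmas
import Literature.AlgebraicGeometry.Resolution.AlterationsSectionDivisor
import Literature.AlgebraicGeometry.Resolution.RegularCentreLocal
import Mathlib
import HarnessLib

/-!
# [OURS · L1 W4.5(b) · EL♮(3)] E-NEG(1), part 3b-i — the quasi-regular pair of part 2's `hloc` at a PRESCRIBED point of
# `V(D♭)_red`, from ring-level data at the ambient stalk `R = 𝒪_{X₁,q}` (crux `EquisingularLiftNatThree` =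
# stmt-ResolutionOfSingularities-20148, parent stmt-20038)

NOT a statement of any manuscript. Helper file of the chain res-L1-w45b (cell `res-hironaka`, rung L, slot W4.5(b)); AI-written, weaker than
expert review; filed `--supports stmt-ResolutionOfSingularities-20148 --as helper`; it closes nothing. Object (O1) E-NEG(1) of res-L1-w45b-plan-1's
PLANNER-MEMO-g9-1 v1.1, part 3b («scheme plumbing»), first half: the passage from the AMBIENT STALK `R = 𝒪_{X₁,q}` (regular of dimension `4`,
carrier equation `c₀`, uniformizer germ `ϖ`, restricted-centre generators `(c₀, x₁, x₂) = (ker s)_q`, prime `𝔓 = 𝓘(D♭)_q`) to the local ring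
`𝒪_{V(D♭)_red, z} ≅ R ⧸ 𝔓` of the reduced image surface at the point `z` over `q`, producing the data `(z, c, hc, hcm, hcq)` of the conditional
input `hloc` of part 2 (`…NatExactShadowSection.range_subset_image_support_of_exactShadow`, p529064). The ring core is part 3a″
(`…NatCoheightTwoPrime.isQuasiRegular_pair_quotient_prime_of_carrier`, p535170). Part 3b-ii (`…NatExactShadowStalk`) derives the ring-level
inputs (`𝔓` prime, `c₀ ∈ 𝔓 ∌ ϖ`, `dim R ⧸ 𝔓 = 2`, the `𝔪`-primary clause) from the geometry of the exact shadow.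

CONTENT.
* Pure algebra: `not_le_span_sup_span_of_not_mem` — the side condition `𝔓 ⊄ (c₀) + (ϖ)` of part 3a″ FOLLOWS from `ϖ ∉ 𝔓` (coheight-two primes
  of the carrier germ are principal, part 3a′); `height_eq_two_of_chain`, `ringKrullDim_quotient_eq_two_of_chain` — `dim R ⧸ 𝔓 = 2` from two strict
  prime chains `⊥ < P₁ < 𝔓 < Q₁ < 𝔪` in the regular (catenary) `R` of dimension `4`; `radical_span_pair_isMaximal_of_forall_prime` — the `𝔪`-primary
  clause in `R ⧸ 𝔓` from «every prime of `R` over `𝔓 + (ker s)_q` is `𝔪`».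
* Dictionary (`Spec 𝒪_{X,t} → X`, Stacks 01J7): `Γgerm_mem_primeOfSpecializes_iff` (the germ of a global section lies in the prime `𝔭_η` of a
  generisation `η ⤳ t` iff `η` is in its zero locus), `primeOfSpecializes_lt_of_ne`, `primeOfSpecializes_lt_maximalIdeal` (strict specialisations give
  strict inclusions of primes).
* **`exists_isQuasiRegular_pair_of_stalkData`** — the `hloc` data at a prescribed point `z` of `V(𝓘(D))` over `q`, from the ring-level inputs at `R`.

References: H. Matsumura, *Commutative Ring Theory* (1986), §5 p. 31, Thms. 14.2, 17.4 (iii); The Stacks Project, Tag 01J7 — through the cited tree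
files and Mathlib. OURS planning text (index only): L/w45b/PLANNER-MEMO-g9-1.md v1.1 §1 (c1).
-/

set_option linter.dupNamespace false -- mandated namespace `Summit.<Summit>.<Problem>` of this single-conjunct summit

noncomputable section

open CategoryTheory AlgebraicGeometry TopologicalSpace Topology IsLocalRing
open AlgebraicGeometry.Scheme.IdealSheafData Literature.AlgebraicGeometry.Resolution

namespace Summit.ResolutionOfSingularities.ResolutionOfSingularities.Cruxes.EquisingularLiftNat.Sections

universe u

/-! ## §1 Pure algebra at the ambient stalk -/

section Algebra

variable {R : Type u} [CommRing R]

/-- `x + m ≤ n` in `ℕ∞` with `m ≤ n` natural forces `x ≤ n - m`. [folklore] -/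
theorem enat_le_sub_of_add_le {x : ℕ∞} {m n : ℕ} (h : x + m ≤ n) : x ≤ (n - m : ℕ) := by
  induction x using ENat.recTopCoe with
  | top => exact absurd h (by simp)
  | coe a =>
    have : a + m ≤ n := by exact_mod_cast h
    exact_mod_cast (by omega : a ≤ n - m)

/-- **The side condition of part 3a″ follows from `ϖ ∉ 𝔓`.** `R` regular local of dimension `4`, `c₀ ∈ 𝔪 ∖ 𝔪²`, `ϖ ∈ 𝔪`, `𝔓 ∋ c₀` prime with
`dim R ⧸ 𝔓 = 2` and `ϖ ∉ 𝔓` ⟹ `𝔓 ⊄ (c₀) + (ϖ)`: in the carrier germ `A = R ⧸ (c₀)` the prime `𝔓̄` of coheight `2` is `(g)` with `g` prime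
(part 3a′); `g = a ϖ̄` would give `g ∣ ϖ̄` (so `ϖ ∈ 𝔓`) or `g ∣ a` (so `ϖ̄` is a unit). [cite: Matsumura1987, §5 p. 31 and Thm. 20.3] [OURS · L1 W4.5b] -/
theorem not_le_span_sup_span_of_not_mem [IsRegularLocalRing R] (h4 : ringKrullDim R = (4 : ℕ)) {c₀ ϖ : R}
    (hc₀ : c₀ ∈ maximalIdeal R) (hc₀2 : c₀ ∉ maximalIdeal R ^ 2) (hϖ : ϖ ∈ maximalIdeal R)
    (𝔓 : Ideal R) [𝔓.IsPrime] (hc𝔓 : c₀ ∈ 𝔓) (h2 : ringKrullDim (R ⧸ 𝔓) = (2 : ℕ)) (hϖ𝔓 : ϖ ∉ 𝔓) :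
    ¬ 𝔓 ≤ Ideal.span {c₀} ⊔ Ideal.span {ϖ} := by
  classical
  intro hle
  obtain ⟨hA, hdimA⟩ := IsRegularLocalRing.quotient_span_singleton hc₀ hc₀2
  haveI := hA
  set A := R ⧸ Ideal.span {c₀} with hAdef
  set ρ := Ideal.Quotient.mk (Ideal.span {c₀}) with hρ
  haveI : IsDomain A := isDomain_of_isRegularLocalRing A
  have h3 : ringKrullDim A = (3 : ℕ) := by
    obtain ⟨n, hn⟩ := exists_nat_cast_eq_ringKrullDim (R := A)
    rw [hn, h4] at hdimA
    rw [hn]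
    have h' : ((n + 1 : ℕ) : WithBot ℕ∞) = ((4 : ℕ) : WithBot ℕ∞) := by
      rw [← hdimA]; push_cast; rfl
    have h'' : n + 1 = 4 := by exact_mod_cast h'
    have : n = 3 := by omega
    rw [this]
  have hsurj : Function.Surjective ρ := Ideal.Quotient.mk_surjective
  have hle𝔓 : Ideal.span {c₀} ≤ 𝔓 := (Ideal.span_singleton_le_iff_mem _).mpr hc𝔓
  haveI h𝔭 : (𝔓.map ρ).IsPrime :=
    Ideal.map_isPrime_of_surjective hsurj (by rw [hρ, Ideal.mk_ker]; exact hle𝔓)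
  have h2A : ringKrullDim (A ⧸ 𝔓.map ρ) = (2 : ℕ) := by
    rw [ringKrullDim_eq_of_ringEquiv (DoubleQuot.quotQuotEquivQuotOfLE hle𝔓), h2]
  obtain ⟨g, hg, hg𝔭⟩ := exists_prime_span_singleton_eq_of_ringKrullDim_quotient h3 (𝔓.map ρ) h2A
  -- `g ∈ (ϖ̄)`
  have hgmem : g ∈ Ideal.span {ρ ϖ} := by
    have h1 : g ∈ 𝔓.map ρ := by rw [hg𝔭]; exact Ideal.mem_span_singleton_self g
    have h2' : 𝔓.map ρ ≤ Ideal.span {ρ ϖ} := by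
      refine (Ideal.map_mono hle).trans ?_
      rw [Ideal.map_sup, Ideal.map_span, Ideal.map_span, Set.image_singleton, Set.image_singleton]
      have h0 : ρ c₀ = 0 := by rw [hρ, Ideal.Quotient.eq_zero_iff_mem]; exact Ideal.mem_span_singleton_self c₀
      rw [h0, Ideal.span_singleton_eq_bot.mpr rfl, bot_sup_eq]
    exact h2' h1
  obtain ⟨a, ha⟩ := Ideal.mem_span_singleton'.mp hgmem
  -- `g ∣ a ϖ̄ = g`: `g ∣ a` or `g ∣ ϖ̄`
  have hdvd : g ∣ a * ρ ϖ := ⟨1, by rw [ha, mul_one]⟩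
  rcases hg.dvd_or_dvd hdvd with h | h
  · -- `a = g b`, `g = g b ϖ̄`, so `ϖ̄` is a unit
    obtain ⟨b, rfl⟩ := h
    have h1 : g * (1 - b * ρ ϖ) = 0 := by
      have : g = g * b * ρ ϖ := ha.symm
      linear_combination this
    rcases mul_eq_zero.mp h1 with h0 | h0
    · exact hg.ne_zero h0
    · have hunit : IsUnit (ρ ϖ) := isUnit_iff_exists_inv.mpr ⟨b, by linear_combination -h0⟩
      have hmax : (maximalIdeal R).map ρ = maximalIdeal A := map_maximalIdeal_of_surjective ρ hsurj
      have hϖA : ρ ϖ ∈ maximalIdeal A := by rw [← hmax]; exact Ideal.mem_map_of_mem _ hϖ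
      exact hϖA hunit
  · -- `ϖ̄ ∈ (g) = 𝔓̄`, so `ϖ ∈ 𝔓`
    have h1 : ρ ϖ ∈ 𝔓.map ρ := by rw [hg𝔭]; exact (Ideal.mem_span_singleton).mpr h
    rw [Ideal.mem_map_iff_of_surjective ρ hsurj] at h1
    obtain ⟨y, hy, hyϖ⟩ := h1
    apply hϖ𝔓
    have hdiff : ϖ - y ∈ Ideal.span {c₀} := by rw [← Ideal.Quotient.eq, ← hρ, hyϖ]
    have : ϖ = y + (ϖ - y) := by ring
    rw [this]
    exact 𝔓.add_mem hy (hle𝔓 hdiff)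

/-- **The height of the middle prime of two strict chains `⊥ < P₁ < 𝔓 < Q₁ < 𝔪` in a local ring of dimension `4` is `2`.**
[cite: Matsumura1987, §5 p. 31] [folklore] -/
theorem height_eq_two_of_chain [IsLocalRing R] [IsDomain R] (h4 : ringKrullDim R = (4 : ℕ)) {P₁ 𝔓 Q₁ : Ideal R} [P₁.IsPrime]
    [𝔓.IsPrime] [Q₁.IsPrime] (h₁ : P₁ ≠ ⊥) (h₁₂ : P₁ < 𝔓) (h₂₃ : 𝔓 < Q₁) (h₃ : Q₁ < maximalIdeal R) :
    𝔓.height = 2 := by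
  haveI : (⊥ : Ideal R).IsPrime := Ideal.isPrime_bot
  have hm : (maximalIdeal R).height = (4 : ℕ) := by
    have h := IsLocalRing.maximalIdeal_height_eq_ringKrullDim (R := R)
    rw [h4] at h
    exact WithBot.coe_eq_coe.mp (by rw [h]; rfl)
  have a₁ := Ideal.height_add_one_le_of_lt_of_isPrime (bot_lt_iff_ne_bot.mpr h₁)
  rw [Ideal.height_bot, zero_add] at a₁
  have a₂ := Ideal.height_add_one_le_of_lt_of_isPrime h₁₂
  have a₃ := Ideal.height_add_one_le_of_lt_of_isPrime h₂₃
  have a₄ := Ideal.height_add_one_le_of_lt_of_isPrime h₃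
  rw [hm] at a₄
  -- upper bound
  have hQ : Q₁.height ≤ (3 : ℕ) := enat_le_sub_of_add_le (m := 1) (n := 4) a₄
  have h𝔓le : 𝔓.height ≤ (2 : ℕ) :=
    enat_le_sub_of_add_le (m := 1) (n := 3) (a₃.trans hQ)
  -- lower bound
  have h𝔓ge : (2 : ℕ∞) ≤ 𝔓.height := by
    have : (1 : ℕ∞) + 1 ≤ P₁.height + 1 := add_le_add a₁ le_rfl
    exact this.trans a₂
  exact le_antisymm (by exact_mod_cast h𝔓le) h𝔓ge

/-- **`dim R ⧸ 𝔓 = 2`** for the middle prime of two strict chains `⊥ < P₁ < 𝔓 < Q₁ < 𝔪` in a REGULAR local ring of dimension `4`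
(`ht 𝔓 + dim R ⧸ 𝔓 = dim R`, regular local rings being catenary domains). [cite: Matsumura1987, §5 p. 31 and Thm. 17.4] [folklore] -/
theorem ringKrullDim_quotient_eq_two_of_chain [IsRegularLocalRing R] (h4 : ringKrullDim R = (4 : ℕ)) {P₁ 𝔓 Q₁ : Ideal R}
    [P₁.IsPrime] [𝔓.IsPrime] [Q₁.IsPrime] (h₁ : P₁ ≠ ⊥) (h₁₂ : P₁ < 𝔓) (h₂₃ : 𝔓 < Q₁) (h₃ : Q₁ < maximalIdeal R) :
    ringKrullDim (R ⧸ 𝔓) = (2 : ℕ) := by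
  haveI : IsDomain R := isDomain_of_isRegularLocalRing R
  have hht := height_eq_two_of_chain h4 h₁ h₁₂ h₂₃ h₃
  have hsum := height_add_ringKrullDim_quotient (S := R) 𝔓
  rw [hht, h4] at hsum
  haveI : Nontrivial (R ⧸ 𝔓) := Ideal.Quotient.nontrivial_iff.mpr Ideal.IsPrime.ne_top'
  haveI : IsLocalRing (R ⧸ 𝔓) := IsLocalRing.of_surjective' _ Ideal.Quotient.mk_surjective
  obtain ⟨n, hn⟩ := exists_nat_cast_eq_ringKrullDim (R := R ⧸ 𝔓)
  rw [hn] at hsum ⊢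
  have h' : ((2 + n : ℕ) : WithBot ℕ∞) = ((4 : ℕ) : WithBot ℕ∞) := by
    rw [← hsum]; push_cast; rfl
  have h'' : 2 + n = 4 := by exact_mod_cast h'
  have : n = 2 := by omega
  rw [this]

/-- **The `𝔪`-primary clause read in `R ⧸ 𝔓`.** `R` local, `𝔓` a proper ideal, `c₀ ∈ 𝔓`, `x₁, x₂ ∈ 𝔪`; if every prime `𝔯 ⊇ 𝔓` containing
`c₀, x₁, x₂` is `𝔪`, then the ideal `(x̄₁, x̄₂)` of `R ⧸ 𝔓` has maximal radical. [folklore] -/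
theorem radical_span_pair_isMaximal_of_forall_prime [IsLocalRing R] (𝔓 : Ideal R) (h𝔓 : 𝔓 ≠ ⊤) {x₁ x₂ : R}
    (hx₁ : x₁ ∈ maximalIdeal R) (hx₂ : x₂ ∈ maximalIdeal R)
    (hall : ∀ 𝔯 : Ideal R, 𝔯.IsPrime → 𝔓 ≤ 𝔯 → x₁ ∈ 𝔯 → x₂ ∈ 𝔯 → 𝔯 = maximalIdeal R) :
    (Ideal.span {Ideal.Quotient.mk 𝔓 x₁, Ideal.Quotient.mk 𝔓 x₂}).radical.IsMaximal := by
  haveI : Nontrivial (R ⧸ 𝔓) := Ideal.Quotient.nontrivial_iff.mpr h𝔓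
  haveI : IsLocalRing (R ⧸ 𝔓) := IsLocalRing.of_surjective' _ Ideal.Quotient.mk_surjective
  set π := Ideal.Quotient.mk 𝔓 with hπ
  have hsurj : Function.Surjective π := Ideal.Quotient.mk_surjective
  have hmax : (maximalIdeal R).map π = maximalIdeal (R ⧸ 𝔓) := map_maximalIdeal_of_surjective π hsurj
  set I := Ideal.span {π x₁, π x₂} with hI
  have hIle : I ≤ maximalIdeal (R ⧸ 𝔓) := by
    rw [hI, Ideal.span_le, ← hmax]
    rintro _ (rfl | rfl)
    · exact Ideal.mem_map_of_mem _ hx₁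
    · exact Ideal.mem_map_of_mem _ hx₂
  have hrad : I.radical = maximalIdeal (R ⧸ 𝔓) := by
    refine le_antisymm ((Ideal.IsPrime.radical_le_iff inferInstance).mpr hIle) ?_
    rw [Ideal.radical_eq_sInf]
    refine le_sInf ?_
    rintro J ⟨hIJ, hJ⟩
    -- `J = 𝔪̄`: its contraction is a prime over `𝔓` containing `x₁, x₂`
    have hJ' : J.comap π = maximalIdeal R := by
      refine hall _ (Ideal.comap_isPrime π J) ?_ ?_ ?_
      · intro y hy
        rw [Ideal.mem_comap, hπ, Ideal.Quotient.eq_zero_iff_mem.mpr hy]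
        exact J.zero_mem
      · exact hIJ (Ideal.subset_span (by simp))
      · exact hIJ (Ideal.subset_span (by simp))
    have : J = (J.comap π).map π := (Ideal.map_comap_of_surjective π hsurj J).symm
    rw [this, hJ', hmax]
  rw [hrad]
  exact IsLocalRing.maximalIdeal.isMaximal _

end Algebra

/-! ## §2 Dictionary: primes of generisations -/

section Dictionary

variable {X : Scheme.{u}} {t : X}

/-- **The germ of a global section lies in the prime `𝔭_η` of a generisation `η ⤳ t` iff `η` is in its zero locus** (`𝔭_η` is the
contraction of `𝔪_η` along `𝒪_{X,t} → 𝒪_{X,η}`, which takes germs to germs). [cite: StacksProject, Tag 01J7] [folklore] -/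
theorem Γgerm_mem_primeOfSpecializes_iff {η : X} (h : η ⤳ t) (g : Γ(X, ⊤)) :
    (X.presheaf.Γgerm t).hom g ∈ primeOfSpecializes h ↔ η ∈ X.zeroLocus ({g} : Set Γ(X, ⊤)) := by
  change (X.presheaf.stalkSpecializes h).hom ((X.presheaf.germ ⊤ t trivial).hom g) ∈ maximalIdeal _ ↔ _
  rw [TopCat.Presheaf.germ_stalkSpecializes_apply, Scheme.mem_zeroLocus_iff]
  simp only [Set.mem_singleton_iff, forall_eq]
  rw [IsLocalRing.mem_maximalIdeal, mem_nonunits_iff, Scheme.mem_basicOpen]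

/-- **Strict specialisations give strict inclusions of primes**: for generisations `η' ⤳ η ⤳ t` with `η' ≠ η`, `𝔭_{η'} < 𝔭_η` in `𝒪_{X,t}`
(`Spec 𝒪_{X,t} → X` is injective). [cite: StacksProject, Tag 01J7] [folklore] -/
theorem primeOfSpecializes_lt_of_ne {η η' : X} (h : η ⤳ t) (h' : η' ⤳ η) (hne : η' ≠ η) :
    primeOfSpecializes (h'.trans h) < primeOfSpecializes h := by
  refine lt_of_le_of_ne (primeOfSpecializes_mono h h') fun heq => hne ?_
  calc η' = X.fromSpecStalk t ⟨primeOfSpecializes (h'.trans h), inferInstance⟩ :=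
        (Literature.AlgebraicGeometry.Motives.fromSpecStalk_comap_maximalIdeal (h'.trans h)).symm
    _ = X.fromSpecStalk t ⟨primeOfSpecializes h, inferInstance⟩ := by
        congr 1; exact PrimeSpectrum.ext heq
    _ = η := Literature.AlgebraicGeometry.Motives.fromSpecStalk_comap_maximalIdeal h

/-- For a generisation `η ⤳ t` with `η ≠ t`: `𝔭_η < 𝔪_t`. [cite: StacksProject, Tag 01J7] [folklore] -/
theorem primeOfSpecializes_lt_maximalIdeal {η : X} (h : η ⤳ t) (hne : η ≠ t) :
    primeOfSpecializes h < maximalIdeal (X.presheaf.stalk t) := by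
  have key := primeOfSpecializes_lt_of_ne (specializes_refl t) h hne
  have hrefl : primeOfSpecializes (specializes_refl t) = maximalIdeal (X.presheaf.stalk t) := by
    change (maximalIdeal _).comap (X.presheaf.stalkSpecializes (specializes_refl t)).hom = _
    rw [TopCat.Presheaf.stalkSpecializes_refl]
    exact Ideal.comap_id _
  rwa [hrefl] at key

end Dictionary

/-! ## §3 The `hloc` data at a prescribed point of `V(𝓘(D))` -/

section Pair

variable {X : Scheme.{u}}

/-- **E-NEG(1) part 3b-i — the quasi-regular pair at a prescribed point of a closed subscheme.** `X` a scheme, `𝔇` an ideal sheaf with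
closed subscheme `ι : V(𝔇) → X` (the reduced image surface `V(𝓘(D♭))`), `z` a point of it, `q = ι z`; `K` an ideal sheaf on `X` (the centre
`ker s`). At the ambient stalk `R = 𝒪_{X,q}`, regular local of dimension `4`: `c₀ ∈ 𝔪 ∖ 𝔪²` (carrier equation), `ϖ ∈ 𝔪` with `ϖ ∉ 𝔪² + (c₀)`
(uniformizer germ), `K_q = (c₀, x₁, x₂)` with `x₁, x₂ ∈ 𝔪`; and for `𝔓 = 𝔇_q`: `𝔓` prime, `c₀ ∈ 𝔓`, `ϖ ∉ 𝔓`, `dim R ⧸ 𝔓 = 2`, and every prime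
of `R` over `𝔓 ∪ {x₁, x₂}` is `𝔪` (the section meets `D♭` only at `q`). THEN the restricted centre `(K · 𝒪_{V(𝔇)})_z` is generated by a
QUASI-REGULAR PAIR inside `𝔪_z` — the data `(c, hc, hcm, hcq)` of part 2's `hloc` (`𝒪_{V(𝔇),z} ≅ R ⧸ 𝔓` by `ι^♯_z`, onto with kernel `𝔓`;
part 3a″ + `not_le_span_sup_span_of_not_mem`). [cite: Matsumura1987, Thm. 14.2, Thm. 17.4 (iii); StacksProject, Tag 01J7] [OURS · L1 W4.5b] -/
theorem exists_isQuasiRegular_pair_of_stalkData (𝔇 : X.IdealSheafData) (z : ↥𝔇.subscheme) (K : X.IdealSheafData)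
    [IsRegularLocalRing (X.presheaf.stalk (𝔇.subschemeι z))] (h4 : ringKrullDim (X.presheaf.stalk (𝔇.subschemeι z)) = (4 : ℕ))
    (c₀ ϖ x₁ x₂ : X.presheaf.stalk (𝔇.subschemeι z)) (hc₀ : c₀ ∈ maximalIdeal _) (hc₀2 : c₀ ∉ maximalIdeal _ ^ 2)
    (hϖ : ϖ ∈ maximalIdeal _) (hϖ2 : ϖ ∉ maximalIdeal _ ^ 2 ⊔ Ideal.span {c₀})
    (hx₁ : x₁ ∈ maximalIdeal _) (hx₂ : x₂ ∈ maximalIdeal _)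
    (hK : stalkIdeal K (𝔇.subschemeι z) = Ideal.span {c₀, x₁, x₂})
    (hprime : (stalkIdeal 𝔇 (𝔇.subschemeι z)).IsPrime) (hc𝔓 : c₀ ∈ stalkIdeal 𝔇 (𝔇.subschemeι z))
    (hϖ𝔓 : ϖ ∉ stalkIdeal 𝔇 (𝔇.subschemeι z))
    (h2 : ringKrullDim (X.presheaf.stalk (𝔇.subschemeι z) ⧸ stalkIdeal 𝔇 (𝔇.subschemeι z)) = (2 : ℕ))
    (hall : ∀ 𝔯 : Ideal (X.presheaf.stalk (𝔇.subschemeι z)), 𝔯.IsPrime → stalkIdeal 𝔇 (𝔇.subschemeι z) ≤ 𝔯 →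
      x₁ ∈ 𝔯 → x₂ ∈ 𝔯 → 𝔯 = maximalIdeal _) :
    ∃ c : Fin (0 + 2) → 𝔇.subscheme.presheaf.stalk z,
      Ideal.span (Set.range c) = stalkIdeal (K.comap 𝔇.subschemeι) z ∧ (∀ l, c l ∈ maximalIdeal _) ∧ IsQuasiRegular c := by
  classical
  haveI := hprime
  -- `ι^♯_z : R → 𝒪_{V(𝔇), z}` is onto with kernel `𝔓 = 𝔇_q`
  have hsurj : Function.Surjective (𝔇.subschemeι.stalkMap z).hom := 𝔇.subschemeι.stalkMap_surjective z
  have hker : RingHom.ker (𝔇.subschemeι.stalkMap z).hom = stalkIdeal 𝔇 (𝔇.subschemeι z) := by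
    have h := (stalkIdeal_ker_eq_ker_stalkMap 𝔇.subschemeι z).symm
    rw [Scheme.IdealSheafData.ker_subschemeι] at h
    exact h
  let e : (X.presheaf.stalk (𝔇.subschemeι z) ⧸ stalkIdeal 𝔇 (𝔇.subschemeι z)) ≃+* 𝔇.subscheme.presheaf.stalk z :=
    (Ideal.quotEquivOfEq hker.symm).trans (RingHom.quotientKerEquivOfSurjective hsurj)
  have he : ∀ a, e (Ideal.Quotient.mk _ a) = (𝔇.subschemeι.stalkMap z).hom a := fun a => rfl
  -- the side condition and the `𝔪`-primary clause, then part 3a″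
  have hside : ¬ stalkIdeal 𝔇 (𝔇.subschemeι z) ≤ Ideal.span {c₀} ⊔ Ideal.span {ϖ} :=
    not_le_span_sup_span_of_not_mem h4 hc₀ hc₀2 hϖ _ hc𝔓 h2 hϖ𝔓
  have hrad : (Ideal.span {Ideal.Quotient.mk (stalkIdeal 𝔇 (𝔇.subschemeι z)) x₁,
      Ideal.Quotient.mk (stalkIdeal 𝔇 (𝔇.subschemeι z)) x₂}).radical.IsMaximal :=
    radical_span_pair_isMaximal_of_forall_prime _ Ideal.IsPrime.ne_top' hx₁ hx₂ hall
  have hq3 := isQuasiRegular_pair_quotient_prime_of_carrier h4 hc₀ hc₀2 hϖ hϖ2 _ hc𝔓 h2 hside x₁ x₂ hrad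
  refine ⟨![(𝔇.subschemeι.stalkMap z).hom x₁, (𝔇.subschemeι.stalkMap z).hom x₂], ?_, ?_, ?_⟩
  · -- generation: `(K · 𝒪)_z = ι^♯(K_q) = (ι^♯ c₀, ι^♯ x₁, ι^♯ x₂)` and `ι^♯ c₀ = 0`
    have h0 : (𝔇.subschemeι.stalkMap z).hom c₀ = 0 := by
      have : c₀ ∈ RingHom.ker (𝔇.subschemeι.stalkMap z).hom := by rw [hker]; exact hc𝔓
      exact this
    have hr : ∀ a b : 𝔇.subscheme.presheaf.stalk z, Set.range ![a, b] = {a, b} := fun a b => by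
      ext x
      simp only [Set.mem_range, Set.mem_insert_iff, Set.mem_singleton_iff]
      constructor
      · rintro ⟨i, rfl⟩
        fin_cases i
        · exact Or.inl rfl
        · exact Or.inr rfl
      · rintro (rfl | rfl)
        · exact ⟨0, rfl⟩
        · exact ⟨1, rfl⟩
    rw [hr, stalkIdeal_comap_eq_map_stalkMap 𝔇.subschemeι K z, hK, Ideal.map_span, Set.image_insert_eq,
      Set.image_pair, h0, Ideal.span_insert_zero]
  · -- inside `𝔪_z` (`ι^♯_z` is local)
    have hmem : ∀ x : X.presheaf.stalk (𝔇.subschemeι z), x ∈ maximalIdeal _ →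
        (𝔇.subschemeι.stalkMap z).hom x ∈ maximalIdeal _ := fun x hx => by
      rw [IsLocalRing.mem_maximalIdeal] at hx ⊢
      exact (map_mem_nonunits_iff _ x).mpr hx
    intro l
    fin_cases l
    · exact hmem x₁ hx₁
    · exact hmem x₂ hx₂
  · -- quasi-regular, transported along `e`
    have hcomp : (e ∘ ![Ideal.Quotient.mk _ x₁, Ideal.Quotient.mk _ x₂]) =
        ![(𝔇.subschemeι.stalkMap z).hom x₁, (𝔇.subschemeι.stalkMap z).hom x₂] := by
      funext l
      fin_cases l
      · exact he x₁
      · exact he x₂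
    rw [← hcomp]
    exact hq3.map_ringEquiv e

end Pair

end Summit.ResolutionOfSingularities.ResolutionOfSingularities.Cruxes.EquisingularLiftNat.Sections

end
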